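import Literature.NumberTheory.Automorphic.HermitianLatticeTreeIsTree   -- ★ (T1-E) `isTree_latticeTree`, and (T1-A) `latticeTreeIso`, `latticeTreeColoring`
import HarnessLib

/-!
# THE ELLIPTIC EULER–POINCARÉ RELATION `#Fix_γ(U⧸K) + #Fix_γ(U⧸K′) = #Fix_γ(U⧸(K ⊓ K′)) + 1` FROM THE LATTICE TREE
# (Kottwitz 1988 §2; Serre, *Trees*, I.6.1 ∕ II.1.1; Bruhat–Tits 1972 §10; Rogawski 1990 §12.2)

Topic `NumberTheory/Automorphic`; namespace `Literature.NumberTheory.Automorphic.HermitianLatticeTree`.  THEOREMS ONLY (no definition, no instance, no notation, no named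
fact, no `sorry`).  Part (T3)∕(T4), the PAYER of the lattice-tree road: cell `pub/hodgecm-mathlib` (D-0151), crux H413 (stmt-HodgeConjecture-24833), line «N6nsGerm», the
Euler–Poincaré letter (R2) `stub_N6nsR2EP : RankOneEulerPoincareNonsplit` — the ELLIPTIC relation binder `hE` of ★ `Rogawski1990/RankOneEulerPoincareGlue`
(`exists_isLocSmooth_classOrbitalIntegral_eq_one_zero_of_relations{,_congr,_congr'}`) at a TAME non-split place `w`, inert and ramified alike, read on the one-place
model `U = unitaryGroupOfForm σ H ≤ GL₂(E_w)` (A-p17 (g22) bytes; co-hand A-p06 (g27) — the ramified DICTIONARY `hA hB hI`, census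
`F0/P3a/A-p06/g27/CENSUS-R2ram-RamifiedEulerPoincare.A-p06g27.md`; EP pen B-p04 (g34) — the inert dictionary and the CM transport `_congr'`; LEAD F0P3a-plan (g10) WORDS
T9-6 ∕ T9-8 ∕ T9-9).  HONEST LABEL: HC_CM is proved only modulo the printed citations until rung 0 closes; nothing printed is asserted here.

THE THEOREM (`natCard_fixedBy_add_eq_natCard_fixedBy_inf_add_one`).  `E` discretely valued (`[ValuativeRel E] [IsDiscreteValuationRing 𝒪[E]]`), `σ : E →+* E`
valuation-preserving, `ϖ` a uniformizer, `H ∈ M₂(E)` unimodular; `U := unitaryGroupOfForm σ H`, `K := (glInt 2 E).subgroupOf U` (`= Stab_U(L₀)`, `L₀ = 𝒪² = latt 1`),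
`K′ := ((glInt 2 E).map (MulAut.conj g₁)).subgroupOf U` (`= Stab_U(Λ₁)`, `Λ₁ = latt g₁` a `ϖ`-MODULAR lattice with `ϖL₀ ≤ Λ₁ ≤ L₀` — at an inert place `g₁ = diag(1, ϖ)`
for the antidiagonal `Φ₂`).  HYPOTHESES: TRANSITIVITY of `U` on self-dual lattices (`hA`), on `ϖ`-modular lattices (`hB`) and on flags `ϖL ≤ Λ ≤ L` (`hI`) — the
arithmetic input, supplied per place type by ★ `UnitaryGroupSelfDualLocus` (unramified) and A-p06's ramified dictionary; FINITENESS of `Fix_γ(U⧸K)`, `Fix_γ(U⧸K′)` and of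
the `⟨γ⟩`-orbit of the root coset (all three from ★ `UnitOrbitalIntegralFixedPoints.finite_fixedBy_quotient_of_isClosed` ∕ compactness of the centraliser for a
regular elliptic `γ`, on the topological model — B-p04's assembly).  CONCLUSION: `Nat.card Fix_γ(U⧸K) + Nat.card Fix_γ(U⧸K′) = Nat.card Fix_γ(U⧸(K ⊓ K′)) + 1`.
PROOF: the dictionary (A) `Fix(U⧸K) ≃` fixed self-dual vertices, (B) `Fix(U⧸K′) ≃` fixed modular vertices, (I) `Fix(U⧸(K ⊓ K′)) ≃` fixed flags `≃` fixed edges of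
`latticeTree σ ϖ H`; the fixed vertices form a finite set, non-empty by ★ `RootedTree.exists_fixedPoint_of_finite_invariant` (the orbit of the root is a finite
`γ`-stable set and `γ` preserves the type colouring), and ★ `RootedTree.ncard_fixedPoints_eq_ncard_fixedEdges_add_one` on the tree ★ `isTree_latticeTree`.

* dictionary: `mapGL_coe_latt`, `mapGL_coe_latt_mul`, `mk_mem_fixedBy_iff_mapGL_latt_eq` (K), `mk_mem_fixedBy_conj_iff_mapGL_latt_eq` (K′), `mk_eq_mk_iff_latt_eq`,
  `mk_eq_mk_conj_iff_latt_eq`, `mk_mem_fixedBy_inf_iff`, `mk_eq_mk_inf_iff` (K ⊓ K′), `isSelfDualLattice_latt_coe`, `isModularLattice_latt_coe_mul`,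
  `latticeTreeIso_apply_eq_self_iff`.
* (A) `nonempty_fixedBy_equiv_fixed_selfDual`, (B) `nonempty_fixedBy_equiv_fixed_modular`, `edge_latt_coe`, `exists_fixed_flag_of_mem_fixedBy_inf`,
  (I) `nonempty_fixedBy_inf_equiv_fixed_flags`, `nonempty_fixed_flags_equiv_fixed_edges`, `nonempty_fixedBy_inf_equiv_fixed_edges`.
* `exists_latticeTreeIso_apply_eq_self` (a fixed vertex), **`natCard_fixedBy_add_eq_natCard_fixedBy_inf_add_one`** (the relation).

## References
* [Kottwitz1988] R. E. Kottwitz, *Tamagawa numbers*, Ann. of Math. 127 (1988), §2 (Euler–Poincaré functions and fixed facets of the building).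
* [Serre1980Trees] J.-P. Serre, *Trees* (1980), I.6.1 (a group acting without inversion with a bounded orbit fixes a vertex), II.1.1 (the tree of a local field).
* [BruhatTits1972] F. Bruhat, J. Tits, *Groupes réductifs sur un corps local I*, Publ. IHÉS 41 (1972), §3.2, §10 (fixed points of bounded subgroups; rank one).
* [Rogawski1990] J. D. Rogawski, *Automorphic representations of unitary groups in three variables*, Ann. of Math. Stud. 123 (1990), §12.2 p. 176 (the singular
  unstable transfer at non-split places via Euler–Poincaré functions).
* [Kottwitz1986] R. E. Kottwitz, *Base change for unit elements of Hecke algebras*, Compositio Math. 60 (1986), §3; [Laumon1995] G. Laumon, *Cohomology of Drinfeld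
  modular varieties I* (1995), Lemma (5.3.2) p. 136 (fixed cosets = stable lattices).
-/

set_option autoImplicit false

noncomputable section

open scoped ValuativeRel Matrix MatrixGroups
open Matrix ValuativeRel Literature.Combinatorics.SimpleGraph

namespace Literature.NumberTheory.Automorphic.HermitianLatticeTree

variable {E : Type*} [Field E] [ValuativeRel E]

/-! ## §11 THE ELLIPTIC EULER–POINCARÉ RELATION `#Fix(U/K) + #Fix(U/K′) = #Fix(U/(K ⊓ K′)) + 1` FROM THE TREE -/

section Euler

variable (σ : E →+* E) (hσv : ∀ x : E, valuation E (σ x) = valuation E x) {ϖ : E} (hϖ : IsUniformizingElement ϖ)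
  {H : Matrix (Fin 2) (Fin 2) E} (hH : IsUnimodular₂ H)

/-- The lattice of `γ u` is `γ ·` the lattice of `u` (`u, γ ∈ U(σ, H)`). [cite: Kottwitz1986, §3] -/
theorem mapGL_coe_latt (γ u : ↥(unitaryGroupOfForm σ H)) :
    mapGL (γ : GL (Fin 2) E) (latt (((u : GL (Fin 2) E)) : Matrix (Fin 2) (Fin 2) E)) = latt (((γ * u : ↥(unitaryGroupOfForm σ H)) : GL (Fin 2) E) : Matrix (Fin 2) (Fin 2) E) := by
  rw [mapGL_latt, Subgroup.coe_mul]

/-- The lattice of `(γ u) g₁` is `γ ·` the lattice of `u g₁`. [cite: Kottwitz1986, §3] -/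
theorem mapGL_coe_latt_mul (γ u : ↥(unitaryGroupOfForm σ H)) (g₁ : GL (Fin 2) E) :
    mapGL (γ : GL (Fin 2) E) (latt (((u : GL (Fin 2) E) * g₁ : GL (Fin 2) E) : Matrix (Fin 2) (Fin 2) E)) =
      latt ((((γ * u : ↥(unitaryGroupOfForm σ H)) : GL (Fin 2) E) * g₁ : GL (Fin 2) E) : Matrix (Fin 2) (Fin 2) E) := by
  rw [mapGL_latt, Subgroup.coe_mul, mul_assoc]

/-- **Dictionary (K)**: `u K ∈ Fix_γ(U ⧸ K)` iff `γ` fixes the lattice of `u` (`K = U ∩ GL₂(𝒪)`). [cite: Kottwitz1986, §3] [cite: Laumon1995, Lemma (5.3.2) p. 136] -/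
theorem mk_mem_fixedBy_iff_mapGL_latt_eq (γ u : ↥(unitaryGroupOfForm σ H)) :
    ((u : ↥(unitaryGroupOfForm σ H) ⧸ (glInt 2 E).subgroupOf (unitaryGroupOfForm σ H)) ∈
        MulAction.fixedBy (↥(unitaryGroupOfForm σ H) ⧸ (glInt 2 E).subgroupOf (unitaryGroupOfForm σ H)) γ) ↔
      mapGL (γ : GL (Fin 2) E) (latt (((u : GL (Fin 2) E)) : Matrix (Fin 2) (Fin 2) E)) = latt (((u : GL (Fin 2) E)) : Matrix (Fin 2) (Fin 2) E) := by
  rw [mem_fixedBy_quotient_mk_iff, Subgroup.mem_subgroupOf, Subgroup.coe_mul, Subgroup.coe_mul, Subgroup.coe_inv, mapGL,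
    map_span_range_transpose_eq_self_iff]

/-- **Dictionary (K′)**: `u K′ ∈ Fix_γ(U ⧸ K′)` iff `γ` fixes the lattice of `u g₁` (`K′ = U ∩ g₁ GL₂(𝒪) g₁⁻¹ = Stab_U(latt g₁)`). [cite: Kottwitz1986, §3] [cite: Laumon1995, Lemma (5.3.2) p. 136] -/
theorem mk_mem_fixedBy_conj_iff_mapGL_latt_eq (g₁ : GL (Fin 2) E) (γ u : ↥(unitaryGroupOfForm σ H)) :
    ((u : ↥(unitaryGroupOfForm σ H) ⧸ ((glInt 2 E).map (MulAut.conj g₁).toMonoidHom).subgroupOf (unitaryGroupOfForm σ H)) ∈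
        MulAction.fixedBy (↥(unitaryGroupOfForm σ H) ⧸ ((glInt 2 E).map (MulAut.conj g₁).toMonoidHom).subgroupOf (unitaryGroupOfForm σ H)) γ) ↔
      mapGL (γ : GL (Fin 2) E) (latt (((u : GL (Fin 2) E) * g₁ : GL (Fin 2) E) : Matrix (Fin 2) (Fin 2) E)) =
        latt (((u : GL (Fin 2) E) * g₁ : GL (Fin 2) E) : Matrix (Fin 2) (Fin 2) E) := by
  rw [mem_fixedBy_quotient_mk_iff, Subgroup.mem_subgroupOf, Subgroup.coe_mul, Subgroup.coe_mul, Subgroup.coe_inv, Subgroup.mem_map_equiv,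
    MulAut.conj_symm_apply, mapGL, map_span_range_transpose_eq_self_iff]
  have h : g₁⁻¹ * ((u : GL (Fin 2) E)⁻¹ * (γ : GL (Fin 2) E) * (u : GL (Fin 2) E)) * g₁ = ((u : GL (Fin 2) E) * g₁)⁻¹ * (γ : GL (Fin 2) E) * ((u : GL (Fin 2) E) * g₁) := by
    group
  rw [h]

/-- Cosets of `K`: `u K = u′ K` iff `u, u′` have the same lattice. [cite: Kottwitz1986, §3] -/
theorem mk_eq_mk_iff_latt_eq (u u' : ↥(unitaryGroupOfForm σ H)) :
    ((u : ↥(unitaryGroupOfForm σ H) ⧸ (glInt 2 E).subgroupOf (unitaryGroupOfForm σ H)) = u') ↔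
      latt (((u : GL (Fin 2) E)) : Matrix (Fin 2) (Fin 2) E) = latt (((u' : GL (Fin 2) E)) : Matrix (Fin 2) (Fin 2) E) := by
  rw [QuotientGroup.eq, Subgroup.mem_subgroupOf, Subgroup.coe_mul, Subgroup.coe_inv, span_range_transpose_eq_iff]

/-- Cosets of `K′`: `u K′ = u′ K′` iff `u g₁, u′ g₁` have the same lattice. [cite: Kottwitz1986, §3] -/
theorem mk_eq_mk_conj_iff_latt_eq (g₁ : GL (Fin 2) E) (u u' : ↥(unitaryGroupOfForm σ H)) :
    ((u : ↥(unitaryGroupOfForm σ H) ⧸ ((glInt 2 E).map (MulAut.conj g₁).toMonoidHom).subgroupOf (unitaryGroupOfForm σ H)) = u') ↔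
      latt (((u : GL (Fin 2) E) * g₁ : GL (Fin 2) E) : Matrix (Fin 2) (Fin 2) E) = latt (((u' : GL (Fin 2) E) * g₁ : GL (Fin 2) E) : Matrix (Fin 2) (Fin 2) E) := by
  rw [QuotientGroup.eq, Subgroup.mem_subgroupOf, Subgroup.coe_mul, Subgroup.coe_inv, Subgroup.mem_map_equiv, MulAut.conj_symm_apply,
    span_range_transpose_eq_iff]
  have h : g₁⁻¹ * ((u : GL (Fin 2) E)⁻¹ * (u' : GL (Fin 2) E)) * g₁ = ((u : GL (Fin 2) E) * g₁)⁻¹ * ((u' : GL (Fin 2) E) * g₁) := by group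
  rw [h]

/-- **Dictionary (K ⊓ K′)**: `u (K ⊓ K′) ∈ Fix_γ` iff `γ` fixes both lattices `latt u` and `latt (u g₁)` (the EDGE `u · (L₀, Λ₁)`). [cite: Kottwitz1988, §2] -/
theorem mk_mem_fixedBy_inf_iff (g₁ : GL (Fin 2) E) (γ u : ↥(unitaryGroupOfForm σ H)) :
    ((u : ↥(unitaryGroupOfForm σ H) ⧸ ((glInt 2 E).subgroupOf (unitaryGroupOfForm σ H) ⊓ ((glInt 2 E).map (MulAut.conj g₁).toMonoidHom).subgroupOf (unitaryGroupOfForm σ H))) ∈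
        MulAction.fixedBy (↥(unitaryGroupOfForm σ H) ⧸ ((glInt 2 E).subgroupOf (unitaryGroupOfForm σ H) ⊓
          ((glInt 2 E).map (MulAut.conj g₁).toMonoidHom).subgroupOf (unitaryGroupOfForm σ H))) γ) ↔
      mapGL (γ : GL (Fin 2) E) (latt (((u : GL (Fin 2) E)) : Matrix (Fin 2) (Fin 2) E)) = latt (((u : GL (Fin 2) E)) : Matrix (Fin 2) (Fin 2) E) ∧
        mapGL (γ : GL (Fin 2) E) (latt (((u : GL (Fin 2) E) * g₁ : GL (Fin 2) E) : Matrix (Fin 2) (Fin 2) E)) =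
          latt (((u : GL (Fin 2) E) * g₁ : GL (Fin 2) E) : Matrix (Fin 2) (Fin 2) E) := by
  rw [mem_fixedBy_quotient_mk_iff, Subgroup.mem_inf, ← mem_fixedBy_quotient_mk_iff, ← mem_fixedBy_quotient_mk_iff, mk_mem_fixedBy_iff_mapGL_latt_eq,
    mk_mem_fixedBy_conj_iff_mapGL_latt_eq]

/-- Cosets of `K ⊓ K′`: equal iff both lattices agree. [cite: Kottwitz1988, §2] -/
theorem mk_eq_mk_inf_iff (g₁ : GL (Fin 2) E) (u u' : ↥(unitaryGroupOfForm σ H)) :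
    ((u : ↥(unitaryGroupOfForm σ H) ⧸ ((glInt 2 E).subgroupOf (unitaryGroupOfForm σ H) ⊓ ((glInt 2 E).map (MulAut.conj g₁).toMonoidHom).subgroupOf (unitaryGroupOfForm σ H))) = u') ↔
      latt (((u : GL (Fin 2) E)) : Matrix (Fin 2) (Fin 2) E) = latt (((u' : GL (Fin 2) E)) : Matrix (Fin 2) (Fin 2) E) ∧
        latt (((u : GL (Fin 2) E) * g₁ : GL (Fin 2) E) : Matrix (Fin 2) (Fin 2) E) = latt (((u' : GL (Fin 2) E) * g₁ : GL (Fin 2) E) : Matrix (Fin 2) (Fin 2) E) := by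
  rw [QuotientGroup.eq, Subgroup.mem_inf, ← QuotientGroup.eq, ← QuotientGroup.eq, mk_eq_mk_iff_latt_eq, mk_eq_mk_conj_iff_latt_eq]

include hH in
/-- The lattice of `u ∈ U(σ, H)` is self-dual. [cite: Jacobowitz1962, §7] -/
theorem isSelfDualLattice_latt_coe (u : ↥(unitaryGroupOfForm σ H)) : IsSelfDualLattice σ H (latt (((u : GL (Fin 2) E)) : Matrix (Fin 2) (Fin 2) E)) := by
  have h := isSelfDualLattice_mapGL σ H (u : GL (Fin 2) E) u.2 (isSelfDualLattice_latt_one σ hH)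
  rwa [show (1 : Matrix (Fin 2) (Fin 2) E) = ((1 : GL (Fin 2) E) : Matrix (Fin 2) (Fin 2) E) from Units.val_one.symm, mapGL_latt, mul_one] at h

/-- The lattice of `u g₁` is `ϖ`-modular when `latt g₁` is. [cite: Jacobowitz1962, §8] -/
theorem isModularLattice_latt_coe_mul {g₁ : GL (Fin 2) E} (hg₁ : IsModularLattice σ ϖ H (latt (g₁ : Matrix (Fin 2) (Fin 2) E))) (u : ↥(unitaryGroupOfForm σ H)) :
    IsModularLattice σ ϖ H (latt (((u : GL (Fin 2) E) * g₁ : GL (Fin 2) E) : Matrix (Fin 2) (Fin 2) E)) := by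
  have h := isModularLattice_mapGL σ ϖ H (u : GL (Fin 2) E) u.2 hg₁
  rwa [mapGL_latt] at h

/-- `α_γ v = v` iff `γ` fixes the lattice `v`. [cite: BruhatTits1972, §10] -/
theorem latticeTreeIso_apply_eq_self_iff (γ : ↥(unitaryGroupOfForm σ H)) (v : {M : Submodule 𝒪[E] (Fin 2 → E) // IsSpecialLattice σ ϖ H M}) :
    latticeTreeIso σ ϖ H γ v = v ↔ mapGL (γ : GL (Fin 2) E) v.1 = v.1 := by
  rw [← Subtype.coe_inj, latticeTreeIso_apply_coe]
  rfl

include hH in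
/-- **(A) `Fix_γ(U ⧸ K)` ≃ the `γ`-fixed self-dual vertices** (when `U` is transitive on self-dual lattices). [cite: Kottwitz1988, §2] [cite: Kottwitz1986, §3] -/
theorem nonempty_fixedBy_equiv_fixed_selfDual
    (hA : ∀ M : Submodule 𝒪[E] (Fin 2 → E), IsSelfDualLattice σ H M → ∃ u : ↥(unitaryGroupOfForm σ H), latt (((u : GL (Fin 2) E)) : Matrix (Fin 2) (Fin 2) E) = M) (γ : ↥(unitaryGroupOfForm σ H)) :
    Nonempty (MulAction.fixedBy (↥(unitaryGroupOfForm σ H) ⧸ (glInt 2 E).subgroupOf (unitaryGroupOfForm σ H)) γ ≃ ↥{v : {M : Submodule 𝒪[E] (Fin 2 → E) // IsSpecialLattice σ ϖ H M} | latticeTreeIso σ ϖ H γ v = v ∧ IsSelfDualLattice σ H v.1}) := by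
  classical
  refine ⟨(Equiv.ofBijective (fun v : ↥{v : {M : Submodule 𝒪[E] (Fin 2 → E) // IsSpecialLattice σ ϖ H M} | latticeTreeIso σ ϖ H γ v = v ∧ IsSelfDualLattice σ H v.1} =>
    (⟨((Classical.choose (hA v.1.1 v.2.2) : ↥(unitaryGroupOfForm σ H)) : ↥(unitaryGroupOfForm σ H) ⧸ (glInt 2 E).subgroupOf (unitaryGroupOfForm σ H)), ?_⟩ : MulAction.fixedBy (↥(unitaryGroupOfForm σ H) ⧸ (glInt 2 E).subgroupOf (unitaryGroupOfForm σ H)) γ)) ⟨?_, ?_⟩).symm⟩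
  · have hu := Classical.choose_spec (hA v.1.1 v.2.2)
    exact (mk_mem_fixedBy_iff_mapGL_latt_eq σ γ _).2
      (((congrArg (mapGL (γ : GL (Fin 2) E)) hu).trans ((latticeTreeIso_apply_eq_self_iff σ _ _).1 v.2.1)).trans hu.symm)
  · intro v w hvw
    have h := hvw
    simp only [Subtype.mk.injEq] at h
    have h' := (mk_eq_mk_iff_latt_eq σ _ _).1 h
    exact Subtype.ext (Subtype.ext (((Classical.choose_spec (hA v.1.1 v.2.2)).symm.trans h').trans (Classical.choose_spec (hA w.1.1 w.2.2))))
  · rintro ⟨x, hx⟩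
    induction x using QuotientGroup.induction_on with
    | H u =>
      refine ⟨⟨⟨latt (((u : GL (Fin 2) E)) : Matrix (Fin 2) (Fin 2) E), Or.inl (isSelfDualLattice_latt_coe σ hH u)⟩,
        (latticeTreeIso_apply_eq_self_iff σ _ _).2 ((mk_mem_fixedBy_iff_mapGL_latt_eq σ γ u).1 hx), isSelfDualLattice_latt_coe σ hH u⟩, ?_⟩
      apply Subtype.ext
      exact (mk_eq_mk_iff_latt_eq σ _ _).2 (Classical.choose_spec (hA _ (isSelfDualLattice_latt_coe σ hH u)))

/-- **(B) `Fix_γ(U ⧸ K′)` ≃ the `γ`-fixed `ϖ`-modular vertices** (when `U` is transitive on `ϖ`-modular lattices; `K′ = Stab_U(latt g₁)`). [cite: Kottwitz1988, §2] [cite: Kottwitz1986, §3] -/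
theorem nonempty_fixedBy_equiv_fixed_modular {g₁ : GL (Fin 2) E} (hg₁ : IsModularLattice σ ϖ H (latt (g₁ : Matrix (Fin 2) (Fin 2) E)))
    (hB : ∀ M : Submodule 𝒪[E] (Fin 2 → E), IsModularLattice σ ϖ H M →
      ∃ u : ↥(unitaryGroupOfForm σ H), latt (((u : GL (Fin 2) E) * g₁ : GL (Fin 2) E) : Matrix (Fin 2) (Fin 2) E) = M) (γ : ↥(unitaryGroupOfForm σ H)) :
    Nonempty (MulAction.fixedBy (↥(unitaryGroupOfForm σ H) ⧸ ((glInt 2 E).map (MulAut.conj g₁).toMonoidHom).subgroupOf (unitaryGroupOfForm σ H)) γ ≃ ↥{v : {M : Submodule 𝒪[E] (Fin 2 → E) // IsSpecialLattice σ ϖ H M} | latticeTreeIso σ ϖ H γ v = v ∧ IsModularLattice σ ϖ H v.1}) := by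
  classical
  refine ⟨(Equiv.ofBijective (fun v : ↥{v : {M : Submodule 𝒪[E] (Fin 2 → E) // IsSpecialLattice σ ϖ H M} | latticeTreeIso σ ϖ H γ v = v ∧ IsModularLattice σ ϖ H v.1} =>
    (⟨((Classical.choose (hB v.1.1 v.2.2) : ↥(unitaryGroupOfForm σ H)) : ↥(unitaryGroupOfForm σ H) ⧸ ((glInt 2 E).map (MulAut.conj g₁).toMonoidHom).subgroupOf (unitaryGroupOfForm σ H)), ?_⟩ : MulAction.fixedBy (↥(unitaryGroupOfForm σ H) ⧸ ((glInt 2 E).map (MulAut.conj g₁).toMonoidHom).subgroupOf (unitaryGroupOfForm σ H)) γ)) ⟨?_, ?_⟩).symm⟩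
  · have hu := Classical.choose_spec (hB v.1.1 v.2.2)
    exact (mk_mem_fixedBy_conj_iff_mapGL_latt_eq σ g₁ γ _).2
      (((congrArg (mapGL (γ : GL (Fin 2) E)) hu).trans ((latticeTreeIso_apply_eq_self_iff σ _ _).1 v.2.1)).trans hu.symm)
  · intro v w hvw
    have h := hvw
    simp only [Subtype.mk.injEq] at h
    have h' := (mk_eq_mk_conj_iff_latt_eq σ g₁ _ _).1 h
    exact Subtype.ext (Subtype.ext (((Classical.choose_spec (hB v.1.1 v.2.2)).symm.trans h').trans (Classical.choose_spec (hB w.1.1 w.2.2))))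
  · rintro ⟨x, hx⟩
    induction x using QuotientGroup.induction_on with
    | H u =>
      refine ⟨⟨⟨latt (((u : GL (Fin 2) E) * g₁ : GL (Fin 2) E) : Matrix (Fin 2) (Fin 2) E), Or.inr (isModularLattice_latt_coe_mul σ hg₁ u)⟩,
        (latticeTreeIso_apply_eq_self_iff σ _ _).2 ((mk_mem_fixedBy_conj_iff_mapGL_latt_eq σ g₁ γ u).1 hx), isModularLattice_latt_coe_mul σ hg₁ u⟩, ?_⟩
      apply Subtype.ext
      exact (mk_eq_mk_conj_iff_latt_eq σ g₁ _ _).2 (Classical.choose_spec (hB _ (isModularLattice_latt_coe_mul σ hg₁ u)))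

include hH in
/-- The edge `u · (L₀, Λ₁)`: `latt u` is self-dual, `latt (u g₁)` is `ϖ`-modular and `ϖ · latt u ≤ latt (u g₁) ≤ latt u`. [cite: Serre1980Trees, II.1.1] -/
theorem edge_latt_coe {g₁ : GL (Fin 2) E} (hg₁ : IsModularLattice σ ϖ H (latt (g₁ : Matrix (Fin 2) (Fin 2) E)))
    (hadj₁ : scaleLattice ϖ (latt (1 : Matrix (Fin 2) (Fin 2) E)) ≤ latt (g₁ : Matrix (Fin 2) (Fin 2) E)) (hadj₂ : latt (g₁ : Matrix (Fin 2) (Fin 2) E) ≤ latt 1)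
    (u : ↥(unitaryGroupOfForm σ H)) :
    IsSelfDualLattice σ H (latt (((u : GL (Fin 2) E)) : Matrix (Fin 2) (Fin 2) E)) ∧ IsModularLattice σ ϖ H (latt (((u : GL (Fin 2) E) * g₁ : GL (Fin 2) E) : Matrix (Fin 2) (Fin 2) E)) ∧ scaleLattice ϖ (latt (((u : GL (Fin 2) E)) : Matrix (Fin 2) (Fin 2) E)) ≤ latt (((u : GL (Fin 2) E) * g₁ : GL (Fin 2) E) : Matrix (Fin 2) (Fin 2) E) ∧ latt (((u : GL (Fin 2) E) * g₁ : GL (Fin 2) E) : Matrix (Fin 2) (Fin 2) E) ≤ latt (((u : GL (Fin 2) E)) : Matrix (Fin 2) (Fin 2) E) := by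
  refine ⟨isSelfDualLattice_latt_coe σ hH u, isModularLattice_latt_coe_mul σ hg₁ u, ?_, ?_⟩
  · have h1 := (mapGL_le_mapGL_iff (u : GL (Fin 2) E) _ _).2 hadj₁
    rwa [mapGL_scaleLattice, show (1 : Matrix (Fin 2) (Fin 2) E) = ((1 : GL (Fin 2) E) : Matrix (Fin 2) (Fin 2) E) from Units.val_one.symm, mapGL_latt,
      mapGL_latt, mul_one] at h1
  · have h1 := (mapGL_le_mapGL_iff (u : GL (Fin 2) E) _ _).2 hadj₂
    rwa [show (1 : Matrix (Fin 2) (Fin 2) E) = ((1 : GL (Fin 2) E) : Matrix (Fin 2) (Fin 2) E) from Units.val_one.symm, mapGL_latt, mapGL_latt,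
      mul_one] at h1

include hH in
/-- Every `γ`-fixed coset `u (K ⊓ K′)` comes from the `γ`-fixed flag `(latt u, latt (u g₁))`. [cite: Kottwitz1988, §2] [cite: Serre1980Trees, II.1.1] -/
theorem exists_fixed_flag_of_mem_fixedBy_inf {g₁ : GL (Fin 2) E} (hg₁ : IsModularLattice σ ϖ H (latt (g₁ : Matrix (Fin 2) (Fin 2) E)))
    (hadj₁ : scaleLattice ϖ (latt (1 : Matrix (Fin 2) (Fin 2) E)) ≤ latt (g₁ : Matrix (Fin 2) (Fin 2) E)) (hadj₂ : latt (g₁ : Matrix (Fin 2) (Fin 2) E) ≤ latt 1)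
    (γ : ↥(unitaryGroupOfForm σ H)) (x : ↥(unitaryGroupOfForm σ H) ⧸ ((glInt 2 E).subgroupOf (unitaryGroupOfForm σ H) ⊓ ((glInt 2 E).map (MulAut.conj g₁).toMonoidHom).subgroupOf (unitaryGroupOfForm σ H))) (hx : x ∈ MulAction.fixedBy (↥(unitaryGroupOfForm σ H) ⧸ ((glInt 2 E).subgroupOf (unitaryGroupOfForm σ H) ⊓ ((glInt 2 E).map (MulAut.conj g₁).toMonoidHom).subgroupOf (unitaryGroupOfForm σ H))) γ) :
    ∃ p : {p : {M : Submodule 𝒪[E] (Fin 2 → E) // IsSpecialLattice σ ϖ H M} × {M : Submodule 𝒪[E] (Fin 2 → E) // IsSpecialLattice σ ϖ H M} // IsSelfDualLattice σ H p.1.1 ∧ IsModularLattice σ ϖ H p.2.1 ∧ scaleLattice ϖ p.1.1 ≤ p.2.1 ∧ p.2.1 ≤ p.1.1 ∧ latticeTreeIso σ ϖ H γ p.1 = p.1 ∧ latticeTreeIso σ ϖ H γ p.2 = p.2}, ∀ u' : ↥(unitaryGroupOfForm σ H), latt (((u' : GL (Fin 2) E)) : Matrix (Fin 2) (Fin 2)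 E) = p.1.1.1 → latt (((u' : GL (Fin 2) E) * g₁ : GL (Fin 2) E) : Matrix (Fin 2) (Fin 2) E) = p.1.2.1 → (u' : ↥(unitaryGroupOfForm σ H) ⧸ ((glInt 2 E).subgroupOf (unitaryGroupOfForm σ H) ⊓ ((glInt 2 E).map (MulAut.conj g₁).toMonoidHom).subgroupOf (unitaryGroupOfForm σ H))) = x := by
  induction x using QuotientGroup.induction_on with
  | H u =>
    have hx' := (mk_mem_fixedBy_inf_iff σ g₁ γ u).1 hx
    obtain ⟨h1, h2, h3, h4⟩ := edge_latt_coe σ hH hg₁ hadj₁ hadj₂ u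
    refine ⟨⟨(⟨latt (((u : GL (Fin 2) E)) : Matrix (Fin 2) (Fin 2) E), Or.inl h1⟩, ⟨latt (((u : GL (Fin 2) E) * g₁ : GL (Fin 2) E) : Matrix (Fin 2) (Fin 2) E), Or.inr h2⟩),
      h1, h2, h3, h4, (latticeTreeIso_apply_eq_self_iff σ _ _).2 hx'.1, (latticeTreeIso_apply_eq_self_iff σ _ _).2 hx'.2⟩, fun u' hu1 hu2 => ?_⟩
    exact (mk_eq_mk_inf_iff σ g₁ _ _).2 ⟨hu1, hu2⟩

include hH in
/-- **(I, cosets → flags)** `Fix_γ(U ⧸ (K ⊓ K′))` ≃ the `γ`-fixed flags `(L self-dual, Λ modular, ϖL ≤ Λ ≤ L)` (when `U` is transitive on such flags).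
[cite: Kottwitz1988, §2] [cite: Serre1980Trees, II.1.1] -/
theorem nonempty_fixedBy_inf_equiv_fixed_flags {g₁ : GL (Fin 2) E} (hg₁ : IsModularLattice σ ϖ H (latt (g₁ : Matrix (Fin 2) (Fin 2) E)))
    (hadj₁ : scaleLattice ϖ (latt (1 : Matrix (Fin 2) (Fin 2) E)) ≤ latt (g₁ : Matrix (Fin 2) (Fin 2) E)) (hadj₂ : latt (g₁ : Matrix (Fin 2) (Fin 2) E) ≤ latt 1)
    (hI : ∀ M N : Submodule 𝒪[E] (Fin 2 → E), IsSelfDualLattice σ H M → IsModularLattice σ ϖ H N → scaleLattice ϖ M ≤ N → N ≤ M →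
      ∃ u : ↥(unitaryGroupOfForm σ H), latt (((u : GL (Fin 2) E)) : Matrix (Fin 2) (Fin 2) E) = M ∧ latt (((u : GL (Fin 2) E) * g₁ : GL (Fin 2) E) : Matrix (Fin 2) (Fin 2) E) = N) (γ : ↥(unitaryGroupOfForm σ H)) :
    Nonempty (MulAction.fixedBy (↥(unitaryGroupOfForm σ H) ⧸ ((glInt 2 E).subgroupOf (unitaryGroupOfForm σ H) ⊓ ((glInt 2 E).map (MulAut.conj g₁).toMonoidHom).subgroupOf (unitaryGroupOfForm σ H))) γ ≃ {p : {M : Submodule 𝒪[E] (Fin 2 → E) // IsSpecialLattice σ ϖ H M} × {M : Submodule 𝒪[E] (Fin 2 → E) // IsSpecialLattice σ ϖ H M} // IsSelfDualLattice σ H p.1.1 ∧ IsModularLattice σ ϖ H p.2.1 ∧ scaleLattice ϖ p.1.1 ≤ p.2.1 ∧ p.2.1 ≤ p.1.1 ∧ latticeTreeIso σ ϖ H γ p.1 = p.1 ∧ latticeTreeIso σ ϖ H γ p.2 = p.2}) := by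
  classical
  -- a transversal `φ` of the fixed flags (choice applied to `hI`)
  obtain ⟨φ, hφ⟩ : ∃ φ : {p : {M : Submodule 𝒪[E] (Fin 2 → E) // IsSpecialLattice σ ϖ H M} × {M : Submodule 𝒪[E] (Fin 2 → E) // IsSpecialLattice σ ϖ H M} // IsSelfDualLattice σ H p.1.1 ∧ IsModularLattice σ ϖ H p.2.1 ∧ scaleLattice ϖ p.1.1 ≤ p.2.1 ∧ p.2.1 ≤ p.1.1 ∧ latticeTreeIso σ ϖ H γ p.1 = p.1 ∧ latticeTreeIso σ ϖ H γ p.2 = p.2} → ↥(unitaryGroupOfForm σ H), ∀ p, latt (((φ p : GL (Fin 2) E)) : Matrix (Fin 2) (Fin 2) E) = p.1.1.1 ∧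
      latt (((φ p : GL (Fin 2) E) * g₁ : GL (Fin 2) E) : Matrix (Fin 2) (Fin 2) E) = p.1.2.1 :=
    ⟨fun p => Classical.choose (hI p.1.1.1 p.1.2.1 p.2.1 p.2.2.1 p.2.2.2.1 p.2.2.2.2.1),
      fun p => Classical.choose_spec (hI p.1.1.1 p.1.2.1 p.2.1 p.2.2.1 p.2.2.2.1 p.2.2.2.2.1)⟩
  have hmem : ∀ p : {p : {M : Submodule 𝒪[E] (Fin 2 → E) // IsSpecialLattice σ ϖ H M} × {M : Submodule 𝒪[E] (Fin 2 → E) // IsSpecialLattice σ ϖ H M} // IsSelfDualLattice σ H p.1.1 ∧ IsModularLattice σ ϖ H p.2.1 ∧ scaleLattice ϖ p.1.1 ≤ p.2.1 ∧ p.2.1 ≤ p.1.1 ∧ latticeTreeIso σ ϖ H γ p.1 = p.1 ∧ latticeTreeIso σ ϖ H γ p.2 = p.2}, ((φ p : ↥(unitaryGroupOfForm σ H)) : ↥(unitaryGroupOfForm σ H) ⧸ ((glInt 2 E).subgroupOf (unitaryGroupOfForm σ H) ⊓ ((glInt 2 E).map (MulAut.conj g₁).toMonoidHom).subgroupOf (unitaryGroupOfForm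 σ H))) ∈ MulAction.fixedBy (↥(unitaryGroupOfForm σ H) ⧸ ((glInt 2 E).subgroupOf (unitaryGroupOfForm σ H) ⊓ ((glInt 2 E).map (MulAut.conj g₁).toMonoidHom).subgroupOf (unitaryGroupOfForm σ H))) γ := fun p =>
    (mk_mem_fixedBy_inf_iff σ g₁ γ _).2
      ⟨((congrArg (mapGL (γ : GL (Fin 2) E)) (hφ p).1).trans ((latticeTreeIso_apply_eq_self_iff σ _ _).1 p.2.2.2.2.2.1)).trans (hφ p).1.symm,
        ((congrArg (mapGL (γ : GL (Fin 2) E)) (hφ p).2).trans ((latticeTreeIso_apply_eq_self_iff σ _ _).1 p.2.2.2.2.2.2)).trans (hφ p).2.symm⟩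
  refine ⟨(Equiv.ofBijective (fun p : {p : {M : Submodule 𝒪[E] (Fin 2 → E) // IsSpecialLattice σ ϖ H M} × {M : Submodule 𝒪[E] (Fin 2 → E) // IsSpecialLattice σ ϖ H M} // IsSelfDualLattice σ H p.1.1 ∧ IsModularLattice σ ϖ H p.2.1 ∧ scaleLattice ϖ p.1.1 ≤ p.2.1 ∧ p.2.1 ≤ p.1.1 ∧ latticeTreeIso σ ϖ H γ p.1 = p.1 ∧ latticeTreeIso σ ϖ H γ p.2 = p.2} => (⟨((φ p : ↥(unitaryGroupOfForm σ H)) : ↥(unitaryGroupOfForm σ H) ⧸ ((glInt 2 E).subgroupOf (unitaryGroupOfForm σ H) ⊓ ((glInt 2 E).map (MulAut.conj g₁).toMonoidHom).subgroupOf (unitaryGroupOfForm σ H))), hmem p⟩ : MulAction.fixedBy (↥(unitaryGroupOfForm σ H) ⧸ ((glInt 2 E).subgroupOf (unitaryGroupOfForm σ H) ⊓ ((glInt 2 E).map (MulAut.conj g₁).toMonoidHom).subgroupOf (unitaryGroupOfForm σ H))) γ)) ⟨?_, ?_⟩).symm⟩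
  · intro p q hpq
    have h := hpq
    simp only [Subtype.mk.injEq] at h
    have h' := (mk_eq_mk_inf_iff σ g₁ _ _).1 h
    exact Subtype.ext (Prod.ext (Subtype.ext (((hφ p).1.symm.trans h'.1).trans (hφ q).1)) (Subtype.ext (((hφ p).2.symm.trans h'.2).trans (hφ q).2)))
  · rintro ⟨x, hx⟩
    obtain ⟨p, hp⟩ := exists_fixed_flag_of_mem_fixedBy_inf σ hH hg₁ hadj₁ hadj₂ γ x hx
    exact ⟨p, Subtype.ext (hp _ (hφ p).1 (hφ p).2)⟩

/-- **(I, flags → edges)** the `γ`-fixed flags `(L, Λ)` ≃ the `γ`-fixed edges of the tree (an edge has exactly one self-dual end, `hdisj`). [cite: Serre1980Trees, II.1.1] -/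
theorem nonempty_fixed_flags_equiv_fixed_edges
    (hdisj : ∀ M : Submodule 𝒪[E] (Fin 2 → E), IsSelfDualLattice σ H M → IsModularLattice σ ϖ H M → False) (γ : ↥(unitaryGroupOfForm σ H)) :
    Nonempty ({p : {M : Submodule 𝒪[E] (Fin 2 → E) // IsSpecialLattice σ ϖ H M} × {M : Submodule 𝒪[E] (Fin 2 → E) // IsSpecialLattice σ ϖ H M} // IsSelfDualLattice σ H p.1.1 ∧ IsModularLattice σ ϖ H p.2.1 ∧ scaleLattice ϖ p.1.1 ≤ p.2.1 ∧ p.2.1 ≤ p.1.1 ∧ latticeTreeIso σ ϖ H γ p.1 = p.1 ∧ latticeTreeIso σ ϖ H γ p.2 = p.2} ≃ ↥{e ∈ (latticeTree σ ϖ H).edgeSet | ∀ v ∈ e, latticeTreeIso σ ϖ H γ v = v}) := by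
  classical
  refine ⟨Equiv.ofBijective (fun p : {p : {M : Submodule 𝒪[E] (Fin 2 → E) // IsSpecialLattice σ ϖ H M} × {M : Submodule 𝒪[E] (Fin 2 → E) // IsSpecialLattice σ ϖ H M} // IsSelfDualLattice σ H p.1.1 ∧ IsModularLattice σ ϖ H p.2.1 ∧ scaleLattice ϖ p.1.1 ≤ p.2.1 ∧ p.2.1 ≤ p.1.1 ∧ latticeTreeIso σ ϖ H γ p.1 = p.1 ∧ latticeTreeIso σ ϖ H γ p.2 = p.2} => ⟨s(p.1.1, p.1.2), ?_, ?_⟩) ⟨?_, ?_⟩⟩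
  · rw [SimpleGraph.mem_edgeSet, latticeTree_adj_iff]
    exact ⟨fun h => hdisj _ p.2.1 (by rw [h]; exact p.2.2.1), Or.inl ⟨p.2.1, p.2.2.1, p.2.2.2.1, p.2.2.2.2.1⟩⟩
  · intro v hv
    rw [Sym2.mem_iff] at hv
    rcases hv with rfl | rfl
    · exact p.2.2.2.2.2.1
    · exact p.2.2.2.2.2.2
  · intro p q hpq
    have h := hpq
    simp only [Subtype.mk.injEq] at h
    rw [Sym2.eq_iff] at h
    rcases h with ⟨h1, h2⟩ | ⟨h1, h2⟩
    · exact Subtype.ext (Prod.ext h1 h2)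
    · exact (hdisj _ p.2.1 (by rw [h1]; exact q.2.2.1)).elim
  · rintro ⟨e, he, hfix⟩
    induction e using Sym2.ind with
    | h a b =>
      rw [SimpleGraph.mem_edgeSet, latticeTree_adj_iff] at he
      obtain ⟨-, he⟩ := he
      rcases he with ⟨h1, h2, h3, h4⟩ | ⟨h1, h2, h3, h4⟩
      · exact ⟨⟨(a, b), h1, h2, h3, h4, hfix a (Sym2.mem_mk_left a b), hfix b (Sym2.mem_mk_right a b)⟩, rfl⟩
      · exact ⟨⟨(b, a), h1, h2, h3, h4, hfix b (Sym2.mem_mk_right a b), hfix a (Sym2.mem_mk_left a b)⟩, Subtype.ext Sym2.eq_swap⟩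

include hσv hϖ hH in
/-- **(I) `Fix_γ(U ⧸ (K ⊓ K′))` ≃ the `γ`-fixed edges** (when `U` is transitive on the edges; `ϖL₀ ≤ latt g₁ ≤ L₀` the base edge at the root).
[cite: Kottwitz1988, §2] [cite: Serre1980Trees, II.1.1] -/
theorem nonempty_fixedBy_inf_equiv_fixed_edges {g₁ : GL (Fin 2) E} (hg₁ : IsModularLattice σ ϖ H (latt (g₁ : Matrix (Fin 2) (Fin 2) E)))
    (hadj₁ : scaleLattice ϖ (latt (1 : Matrix (Fin 2) (Fin 2) E)) ≤ latt (g₁ : Matrix (Fin 2) (Fin 2) E)) (hadj₂ : latt (g₁ : Matrix (Fin 2) (Fin 2) E) ≤ latt 1)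
    (hI : ∀ M N : Submodule 𝒪[E] (Fin 2 → E), IsSelfDualLattice σ H M → IsModularLattice σ ϖ H N → scaleLattice ϖ M ≤ N → N ≤ M →
      ∃ u : ↥(unitaryGroupOfForm σ H), latt (((u : GL (Fin 2) E)) : Matrix (Fin 2) (Fin 2) E) = M ∧ latt (((u : GL (Fin 2) E) * g₁ : GL (Fin 2) E) : Matrix (Fin 2) (Fin 2) E) = N) (γ : ↥(unitaryGroupOfForm σ H)) :
    Nonempty (MulAction.fixedBy (↥(unitaryGroupOfForm σ H) ⧸ ((glInt 2 E).subgroupOf (unitaryGroupOfForm σ H) ⊓ ((glInt 2 E).map (MulAut.conj g₁).toMonoidHom).subgroupOf (unitaryGroupOfForm σ H))) γ ≃ ↥{e ∈ (latticeTree σ ϖ H).edgeSet | ∀ v ∈ e, latticeTreeIso σ ϖ H γ v = v}) := by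
  obtain ⟨eI⟩ := nonempty_fixedBy_inf_equiv_fixed_flags σ hH hg₁ hadj₁ hadj₂ hI γ
  obtain ⟨eP⟩ := nonempty_fixed_flags_equiv_fixed_edges σ (fun M h1 h2 => not_isModularLattice_of_isSelfDualLattice σ hσv hϖ H h1 h2) γ
  exact ⟨eI.trans eP⟩

include hH in
/-- **A vertex fixed by `γ`** exists as soon as the `⟨γ⟩`-orbit of the root coset `K` is finite (e.g. `γ` in a compact subgroup): the orbit of the root is a
finite non-empty `γ`-stable vertex set and `γ` preserves the type colouring (★ `exists_fixedPoint_of_finite_invariant`). [cite: Serre1980Trees, I.6.1, I.4.3]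
[cite: BruhatTits1972, §3.2] -/
theorem exists_latticeTreeIso_apply_eq_self (hT : (latticeTree σ ϖ H).IsTree)
    (hdisj : ∀ M : Submodule 𝒪[E] (Fin 2 → E), IsSelfDualLattice σ H M → IsModularLattice σ ϖ H M → False) (γ : ↥(unitaryGroupOfForm σ H))
    (horb : (Set.range fun n : ℕ => ((γ ^ n : ↥(unitaryGroupOfForm σ H)) : ↥(unitaryGroupOfForm σ H) ⧸ (glInt 2 E).subgroupOf (unitaryGroupOfForm σ H))).Finite) :
    ∃ v : {M : Submodule 𝒪[E] (Fin 2 → E) // IsSpecialLattice σ ϖ H M}, latticeTreeIso σ ϖ H γ v = v := by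
  classical
  let vA : ↥(unitaryGroupOfForm σ H) → {M : Submodule 𝒪[E] (Fin 2 → E) // IsSpecialLattice σ ϖ H M} := fun u => ⟨latt (((u : GL (Fin 2) E)) : Matrix (Fin 2) (Fin 2) E), Or.inl (isSelfDualLattice_latt_coe σ hH u)⟩
  let f : ↥(unitaryGroupOfForm σ H) ⧸ (glInt 2 E).subgroupOf (unitaryGroupOfForm σ H) → {M : Submodule 𝒪[E] (Fin 2 → E) // IsSpecialLattice σ ϖ H M} := fun x =>
    Quotient.liftOn' x vA (by
      intro a b hab
      apply Subtype.ext
      change latt _ = latt _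
      rw [← mk_eq_mk_iff_latt_eq σ a b]
      exact Quotient.sound' hab)
  have hf : ∀ u : ↥(unitaryGroupOfForm σ H), f (u : ↥(unitaryGroupOfForm σ H) ⧸ (glInt 2 E).subgroupOf (unitaryGroupOfForm σ H)) = vA u := fun u => rfl
  refine RootedTree.exists_fixedPoint_of_finite_invariant hT (latticeTreeIso σ ϖ H γ) (latticeTreeColoring hdisj) (latticeTreeColoring_latticeTreeIso hdisj γ)
    (S := f '' Set.range fun n : ℕ => ((γ ^ n : ↥(unitaryGroupOfForm σ H)) : ↥(unitaryGroupOfForm σ H) ⧸ (glInt 2 E).subgroupOf (unitaryGroupOfForm σ H))) (horb.image f) ⟨f ((γ ^ 0 : ↥(unitaryGroupOfForm σ H)) : ↥(unitaryGroupOfForm σ H) ⧸ (glInt 2 E).subgroupOf (unitaryGroupOfForm σ H)), Set.mem_image_of_mem f ⟨0, rfl⟩⟩ ?_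
  rintro s ⟨x, ⟨n, rfl⟩, rfl⟩
  refine ⟨((γ ^ (n + 1) : ↥(unitaryGroupOfForm σ H)) : ↥(unitaryGroupOfForm σ H) ⧸ (glInt 2 E).subgroupOf (unitaryGroupOfForm σ H)), ⟨n + 1, rfl⟩, ?_⟩
  rw [hf, hf]
  apply Subtype.ext
  rw [latticeTreeIso_apply_coe]
  change latt _ = mapGL _ (latt _)
  rw [mapGL_coe_latt, pow_succ']

include hσv hϖ hH in
/-- **THE ELLIPTIC EULER–POINCARÉ RELATION FROM THE TREE.**  `U = U(σ, H)` the unitary group of a unimodular hermitian plane over a discretely valued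
field (`σ` valuation-preserving, `ϖ` a uniformizer), `K = U ∩ GL₂(𝒪)` (the stabiliser of the self-dual root `L₀ = 𝒪²`), `K′ = U ∩ g₁ GL₂(𝒪) g₁⁻¹` (the
stabiliser of a `ϖ`-modular neighbour `Λ₁ = latt g₁` of `L₀`, `ϖL₀ ≤ Λ₁ ≤ L₀`), `U` transitive on the self-dual lattices (`hA`), on the `ϖ`-modular lattices
(`hB`) and on the edges (`hI`).  Then for every `γ ∈ U` with FINITELY many fixed cosets in `U ⧸ K` and `U ⧸ K′` and a FINITE `⟨γ⟩`-orbit of the root coset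
(e.g. `γ` regular elliptic: closed conjugacy class and compact centraliser, ★ `finite_fixedBy_quotient_of_isClosed`)
`#Fix_γ(U ⧸ K) + #Fix_γ(U ⧸ K′) = #Fix_γ(U ⧸ (K ⊓ K′)) + 1`:
the `γ`-fixed vertices of the tree `latticeTree σ ϖ H` form a finite non-empty subtree, whose vertex count (`= #Fix(U⧸K) + #Fix(U⧸K′)` by the dictionary (A), (B))
exceeds its edge count (`= #Fix(U⧸(K ⊓ K′))`, (I)) by one (★ `ncard_fixedPoints_eq_ncard_fixedEdges_add_one`).  This is the elliptic relation (E) of ★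
`Rogawski1990/RankOneEulerPoincareGlue` at a tame non-split place, inert (`K, K′` the two vertex stabilisers, `K ⊓ K′` the Iwahori) or ramified (barycentric
subdivision: `K′` a vertex stabiliser, `K` an edge-midpoint stabiliser) alike.
[cite: Kottwitz1988, §2] [cite: Serre1980Trees, I.6.1, II.1.1] [cite: BruhatTits1972, §10] [cite: Rogawski1990, §12.2 p. 176] -/
theorem natCard_fixedBy_add_eq_natCard_fixedBy_inf_add_one [IsDiscreteValuationRing 𝒪[E]]
    (g₁ : GL (Fin 2) E) (hg₁ : IsModularLattice σ ϖ H (latt (g₁ : Matrix (Fin 2) (Fin 2) E)))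
    (hadj₁ : scaleLattice ϖ (latt (1 : Matrix (Fin 2) (Fin 2) E)) ≤ latt (g₁ : Matrix (Fin 2) (Fin 2) E)) (hadj₂ : latt (g₁ : Matrix (Fin 2) (Fin 2) E) ≤ latt 1)
    (hA : ∀ M : Submodule 𝒪[E] (Fin 2 → E), IsSelfDualLattice σ H M → ∃ u : ↥(unitaryGroupOfForm σ H), latt (((u : GL (Fin 2) E)) : Matrix (Fin 2) (Fin 2) E) = M)
    (hB : ∀ M : Submodule 𝒪[E] (Fin 2 → E), IsModularLattice σ ϖ H M →
      ∃ u : ↥(unitaryGroupOfForm σ H), latt (((u : GL (Fin 2) E) * g₁ : GL (Fin 2) E) : Matrix (Fin 2) (Fin 2) E) = M)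
    (hI : ∀ M N : Submodule 𝒪[E] (Fin 2 → E), IsSelfDualLattice σ H M → IsModularLattice σ ϖ H N → scaleLattice ϖ M ≤ N → N ≤ M →
      ∃ u : ↥(unitaryGroupOfForm σ H), latt (((u : GL (Fin 2) E)) : Matrix (Fin 2) (Fin 2) E) = M ∧
        latt (((u : GL (Fin 2) E) * g₁ : GL (Fin 2) E) : Matrix (Fin 2) (Fin 2) E) = N)
    (γ : ↥(unitaryGroupOfForm σ H))
    (hKfin : (MulAction.fixedBy (↥(unitaryGroupOfForm σ H) ⧸ (glInt 2 E).subgroupOf (unitaryGroupOfForm σ H)) γ).Finite)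
    (hK'fin : (MulAction.fixedBy (↥(unitaryGroupOfForm σ H) ⧸ ((glInt 2 E).map (MulAut.conj g₁).toMonoidHom).subgroupOf (unitaryGroupOfForm σ H)) γ).Finite)
    (horb : (Set.range fun n : ℕ => ((γ ^ n : ↥(unitaryGroupOfForm σ H)) : ↥(unitaryGroupOfForm σ H) ⧸ (glInt 2 E).subgroupOf (unitaryGroupOfForm σ H))).Finite) :
    Nat.card (MulAction.fixedBy (↥(unitaryGroupOfForm σ H) ⧸ (glInt 2 E).subgroupOf (unitaryGroupOfForm σ H)) γ) + Nat.card (MulAction.fixedBy (↥(unitaryGroupOfForm σ H) ⧸ ((glInt 2 E).map (MulAut.conj g₁).toMonoidHom).subgroupOf (unitaryGroupOfForm σ H)) γ) =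
      Nat.card (MulAction.fixedBy (↥(unitaryGroupOfForm σ H) ⧸ ((glInt 2 E).subgroupOf (unitaryGroupOfForm σ H) ⊓ ((glInt 2 E).map (MulAut.conj g₁).toMonoidHom).subgroupOf (unitaryGroupOfForm σ H))) γ) + 1 := by
  classical
  have hdisj : ∀ M : Submodule 𝒪[E] (Fin 2 → E), IsSelfDualLattice σ H M → IsModularLattice σ ϖ H M → False :=
    fun M h1 h2 => not_isModularLattice_of_isSelfDualLattice σ hσv hϖ H h1 h2
  have hT := isTree_latticeTree σ hσv hϖ hH
  obtain ⟨eA⟩ := nonempty_fixedBy_equiv_fixed_selfDual σ hH hA γ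
  obtain ⟨eB⟩ := nonempty_fixedBy_equiv_fixed_modular σ hg₁ hB γ
  obtain ⟨eI⟩ := nonempty_fixedBy_inf_equiv_fixed_edges σ hσv hϖ hH hg₁ hadj₁ hadj₂ hI γ
  haveI : Finite (MulAction.fixedBy (↥(unitaryGroupOfForm σ H) ⧸ (glInt 2 E).subgroupOf (unitaryGroupOfForm σ H)) γ) := hKfin.to_subtype
  haveI : Finite (MulAction.fixedBy (↥(unitaryGroupOfForm σ H) ⧸ ((glInt 2 E).map (MulAut.conj g₁).toMonoidHom).subgroupOf (unitaryGroupOfForm σ H)) γ) := hK'fin.to_subtype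
  have hfinA : {v : {M : Submodule 𝒪[E] (Fin 2 → E) // IsSpecialLattice σ ϖ H M} | latticeTreeIso σ ϖ H γ v = v ∧ IsSelfDualLattice σ H v.1}.Finite := Set.finite_coe_iff.1 (Finite.of_equiv _ eA)
  have hfinB : {v : {M : Submodule 𝒪[E] (Fin 2 → E) // IsSpecialLattice σ ϖ H M} | latticeTreeIso σ ϖ H γ v = v ∧ IsModularLattice σ ϖ H v.1}.Finite := Set.finite_coe_iff.1 (Finite.of_equiv _ eB)
  have hunion : {v : {M : Submodule 𝒪[E] (Fin 2 → E) // IsSpecialLattice σ ϖ H M} | latticeTreeIso σ ϖ H γ v = v} =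
      {v | latticeTreeIso σ ϖ H γ v = v ∧ IsSelfDualLattice σ H v.1} ∪ {v | latticeTreeIso σ ϖ H γ v = v ∧ IsModularLattice σ ϖ H v.1} := by
    ext v
    simp only [Set.mem_setOf_eq, Set.mem_union]
    constructor
    · intro h
      rcases v.2 with h' | h'
      · exact Or.inl ⟨h, h'⟩
      · exact Or.inr ⟨h, h'⟩
    · rintro (⟨h, -⟩ | ⟨h, -⟩) <;> exact h
  have hfin : {v : {M : Submodule 𝒪[E] (Fin 2 → E) // IsSpecialLattice σ ϖ H M} | latticeTreeIso σ ϖ H γ v = v}.Finite := by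
    rw [hunion]
    exact hfinA.union hfinB
  obtain ⟨v₀, hv₀⟩ := exists_latticeTreeIso_apply_eq_self σ hH hT hdisj γ horb
  have hE := RootedTree.ncard_fixedPoints_eq_ncard_fixedEdges_add_one hT (latticeTreeIso σ ϖ H γ) hfin hv₀
  rw [hunion, Set.ncard_union_eq (Set.disjoint_left.2 fun v hv hv' => hdisj _ hv.2 hv'.2) hfinA hfinB] at hE
  rw [Nat.card_congr eA, Nat.card_congr eB, Nat.card_congr eI, Nat.card_coe_set_eq, Nat.card_coe_set_eq, hE, Nat.card_coe_set_eq]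

end Euler

end Literature.NumberTheory.Automorphic.HermitianLatticeTree

end
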